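import Summits.AnomalousDissipation.AnomalousDissipation.Theorems.TaylorCertificatesForcedStandingFlowsIteration
import HarnessLib

/-!
# Route TaylorCertificates — support `ForcedStandingFlows`: identities along the forced iteration and its limit

Helper file for the item `stmt-AnomalousDissipation-14031` (`ForcedStandingFlows`), continuing
`…ForcedStandingFlowsIteration` (Choffrut–Székelyhidi 2014, §2, Step 3 and Lemma 2, run along the
explicit iteration as in the tree's `StationaryEulerIteration`/`StationaryEulerLimit`):
(i) the defects `J(w_k) = ∫ (e - |v_k|²)` are summable; (ii) the point of the forced variant — the
weak identities (`∫ Σᵢ vᵢ∂ᵢθ`, `∫ Σᵢⱼ uᵢⱼ∂ⱼΦᵢ` for divergence-free `Φ`) and the coordinate means of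
every state equal those of the initial field `w₀` (the increments are homogeneous weak
subsolutions with vanishing means), and the pairing with the extra test field `q` moves by at most
`Σ ε_i ≤ θ`; (iii) along the `L²`-fast subsequence the states converge a.e. to the bounded limit
`wlim = (v, u)` with `wlim(x) ∈ 𝒦_{e(x)}` a.e. (closedness of `𝒦^{co}`, vanishing defect, "the
useful consequence of (2.5)"), and identities, means and (up to `θ`) the `q`-pairing pass to the
limit (dominated convergence for linear observables). The tree's `H⁻¹` clause is not needed here.
Reference: A. Choffrut, L. Székelyhidi Jr., SIAM J. Math. Anal. 46 (2014) = arXiv:1401.4301, §2, Step 3, Lemma 2.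
-/

noncomputable section

open scoped InnerProductSpace ContDiff ENNReal Topology Matrix
open Set Function MeasureTheory Metric Filter
open Literature.Analysis.FunctionSpaces Literature.Analysis.FluidPDE
open Literature.Analysis.FluidPDE.StationaryEuler

namespace Summit.AnomalousDissipation.AnomalousDissipation.Theorems

-- the mandated namespace `Summit.<Summit>.<Problem>.Theorems` repeats `AnomalousDissipation` (single-problem summit)
set_option linter.dupNamespace false

namespace ForcedFlows

variable {d : Type*} [Fintype d] [DecidableEq d] [Nonempty d]

namespace FIterData

variable (D : FIterData d)

/-! ## The defects tend to zero -/

/-- `J(w_k) ≥ 0`. [folklore] -/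
theorem defect_nonneg (k : ℕ) : 0 ≤ defect D.e (D.state k) :=
  integral_nonneg fun x => sub_nonneg.2 (D.norm_vel_state_sq_le k x)

/-- `J(w_k) ≤ E_{k+1} - E_k + 3 ε_k`. [folklore] -/
theorem defect_le (k : ℕ) : defect D.e (D.state k) ≤ D.E (k + 1) - D.E k + 3 * D.eps k := by
  rw [D.E_succ]
  have h1 := D.abs_ip_incr_state_le (le_refl k)
  rw [ip_comm] at h1
  have h2 := D.incr_gain k
  rw [← ip_self] at h2
  have := neg_abs_le (ip (D.state k) (D.incr k))
  linarith

/-- **The defects are summable**: `Σ_{k<n} J(w_k) ≤ R² + 3θ`. [cite: ChoffrutSzekelyhidi2014, §2, Step 3] -/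
theorem sum_defect_le (n : ℕ) : ∑ k ∈ Finset.range n, defect D.e (D.state k) ≤ D.R ^ 2 + 3 * D.θ := by
  have h1 : ∑ k ∈ Finset.range n, defect D.e (D.state k) ≤ ∑ k ∈ Finset.range n, (D.E (k + 1) - D.E k + 3 * D.eps k) :=
    Finset.sum_le_sum fun k _ => D.defect_le k
  rw [Finset.sum_add_distrib, Finset.sum_range_sub, ← Finset.mul_sum] at h1
  have h2 := D.E_le n
  have h3 : 0 ≤ D.E 0 := ip_self_nonneg _
  linarith [D.sum_eps_le (Finset.range n)]

/-- The defects are summable. [folklore] -/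
theorem summable_defect : Summable fun k => defect D.e (D.state k) :=
  summable_of_sum_range_le D.defect_nonneg D.sum_defect_le

/-- **The defects tend to zero.** [cite: ChoffrutSzekelyhidi2014, §2, Step 3] -/
theorem tendsto_defect : Tendsto (fun k => defect D.e (D.state k)) atTop (𝓝 0) := D.summable_defect.tendsto_atTop_zero

/-! ## Identities and means along the iteration -/

omit [Nonempty d] in
/-- Splitting of the velocity pairing `∫ Σᵢ vᵢ ∂ᵢθ` over a sum of continuous fields. [folklore] -/
theorem integral_vel_add {a b : UnitAddTorus d → State d} (ha : Continuous a) (hb : Continuous b)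
    {θ : UnitAddTorus d → ℝ} (hθ : Torus.IsSmooth θ) :
    ∫ x, ∑ i, vel (a x + b x) i * Torus.partialDeriv i θ x =
      (∫ x, ∑ i, vel (a x) i * Torus.partialDeriv i θ x) + ∫ x, ∑ i, vel (b x) i * Torus.partialDeriv i θ x := by
  have hci : ∀ {u : UnitAddTorus d → State d}, Continuous u →
      Integrable fun x => ∑ i, vel (u x) i * Torus.partialDeriv i θ x := fun hu =>
    (continuous_finsetSum _ fun i _ => ((PiLp.continuous_apply 2 (fun _ : Idx d => ℝ) (Sum.inl i)).comp hu).mul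
      (hθ.partialDeriv i).continuous).integrable_unitAddTorus
  rw [← integral_add (hci ha) (hci hb)]
  refine integral_congr_ae (Eventually.of_forall fun x => ?_)
  simp only [← Finset.sum_add_distrib]
  exact Finset.sum_congr rfl fun i _ => by rw [vel_add, PiLp.add_apply]; ring

omit [Nonempty d] in
/-- Splitting of the stress pairing `∫ Σᵢⱼ uᵢⱼ ∂ⱼΦᵢ` over a sum of continuous fields. [folklore] -/
theorem integral_str_add {a b : UnitAddTorus d → State d} (ha : Continuous a) (hb : Continuous b)
    {Φ : UnitAddTorus d → Ed d} (hΦ : Torus.IsSmooth Φ) :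
    ∫ x, ∑ i, ∑ j, str (a x + b x) i j * Torus.partialDeriv j (fun y => Φ y i) x =
      (∫ x, ∑ i, ∑ j, str (a x) i j * Torus.partialDeriv j (fun y => Φ y i) x) +
        ∫ x, ∑ i, ∑ j, str (b x) i j * Torus.partialDeriv j (fun y => Φ y i) x := by
  have hci : ∀ {u : UnitAddTorus d → State d}, Continuous u →
      Integrable fun x => ∑ i, ∑ j, str (u x) i j * Torus.partialDeriv j (fun y => Φ y i) x := fun hu =>
    (continuous_finsetSum _ fun i _ => continuous_finsetSum _ fun j _ =>
      ((PiLp.continuous_apply 2 (fun _ : Idx d => ℝ) (Sum.inr (i, j))).comp hu).mul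
        ((hΦ.apply i).partialDeriv j).continuous).integrable_unitAddTorus
  rw [← integral_add (hci ha) (hci hb)]
  refine integral_congr_ae (Eventually.of_forall fun x => ?_)
  simp only [← Finset.sum_add_distrib]
  refine Finset.sum_congr rfl fun i _ => Finset.sum_congr rfl fun j _ => ?_
  rw [str_add, Matrix.add_apply]; ring

/-- **Weak `div v` of the states is that of `w₀`.** [folklore] -/
theorem state_weak_vel (k : ℕ) {θ : UnitAddTorus d → ℝ} (hθ : Torus.IsSmooth θ) :
    ∫ x, ∑ i, vel (D.state k x) i * Torus.partialDeriv i θ x = ∫ x, ∑ i, vel (D.w₀ x) i * Torus.partialDeriv i θ x := by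
  induction k with
  | zero => rfl
  | succ k ih =>
    rw [D.state_succ, integral_vel_add (D.state_continuous k) (D.incr_continuous k) hθ, ih,
      (D.incr_isTorusSub k).1 θ hθ, add_zero]

/-- **Weak `div u` (tested with divergence-free fields) of the states is that of `w₀`.** [folklore] -/
theorem state_weak_str (k : ℕ) {Φ : UnitAddTorus d → Ed d} (hΦ : Torus.IsSmooth Φ) (hdiv : Torus.IsDivFree Φ) :
    ∫ x, ∑ i, ∑ j, str (D.state k x) i j * Torus.partialDeriv j (fun y => Φ y i) x =
      ∫ x, ∑ i, ∑ j, str (D.w₀ x) i j * Torus.partialDeriv j (fun y => Φ y i) x := by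
  induction k with
  | zero => rfl
  | succ k ih =>
    rw [D.state_succ, integral_str_add (D.state_continuous k) (D.incr_continuous k) hΦ, ih,
      (D.incr_isTorusSub k).2 Φ hΦ hdiv, add_zero]

/-- **The coordinate means of the states are those of `w₀`.** [folklore] -/
theorem integral_state_apply (k : ℕ) (c : Idx d) : ∫ x, D.state k x c = ∫ x, D.w₀ x c := by
  induction k with
  | zero => rfl
  | succ k ih =>
    have h1 : Integrable (fun x => D.state k x c) := ((PiLp.continuous_apply 2 (fun _ : Idx d => ℝ) c).comp
      (D.state_continuous k)).integrable_unitAddTorus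
    have h2 : Integrable (fun x => D.incr k x c) := ((PiLp.continuous_apply 2 (fun _ : Idx d => ℝ) c).comp
      (D.incr_continuous k)).integrable_unitAddTorus
    rw [D.state_succ]
    simp only [PiLp.add_apply]
    rw [integral_add h1 h2, ih, D.integral_incr_apply, add_zero]

/-- **The pairing of the states with `q` stays within `Σ_{i<k} ε_i` of that of `w₀`.** [folklore] -/
theorem abs_ip_state_q_sub_le (k : ℕ) : |ip (D.state k) D.q - ip D.w₀ D.q| ≤ ∑ i ∈ Finset.range k, D.eps i := by
  induction k with
  | zero => simp [state_zero]
  | succ k ih =>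
    have h1 : Integrable fun x => ⟪D.state k x, D.q x⟫_ℝ := ((D.state_continuous k).inner D.hq).integrable_unitAddTorus
    have h2 : Integrable fun x => ⟪D.incr k x, D.q x⟫_ℝ := ((D.incr_continuous k).inner D.hq).integrable_unitAddTorus
    have hsplit : ip (D.state (k + 1)) D.q = ip (D.state k) D.q + ip (D.incr k) D.q := by
      simp only [ip, D.state_succ_apply, inner_add_left]
      exact integral_add h1 h2
    rw [hsplit, Finset.sum_range_succ]
    have h3 : |ip (D.incr k) D.q| ≤ D.eps k := D.incr_orth_q k
    calc |ip (D.state k) D.q + ip (D.incr k) D.q - ip D.w₀ D.q|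
        = |(ip (D.state k) D.q - ip D.w₀ D.q) + ip (D.incr k) D.q| := by ring_nf
      _ ≤ |ip (D.state k) D.q - ip D.w₀ D.q| + |ip (D.incr k) D.q| := abs_add_le _ _
      _ ≤ _ := add_le_add ih h3

/-- The pairing with `q` stays within `θ` of that of `w₀`. [folklore] -/
theorem abs_ip_state_q_sub_le_θ (k : ℕ) : |ip (D.state k) D.q - ip D.w₀ D.q| ≤ D.θ :=
  (D.abs_ip_state_q_sub_le k).trans (D.sum_eps_le _)

/-! ## Convergence along the fast subsequence -/

/-- Fast `L²` convergence along the subsequence: `‖w_{φ(j)} - w_{φ(i)}‖² < 4^{-i}` for `i ≤ j`. [folklore] -/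
theorem integral_sq_sub_lt {i j : ℕ} (hij : i ≤ j) :
    ∫ x, ‖D.state (D.sub j) x - D.state (D.sub i) x‖ ^ 2 < (1 / 4) ^ i :=
  D.thr_spec i _ _ (D.thr_le_sub i) (D.sub_strictMono.monotone hij)

/-- `L¹` control of consecutive terms: `∫ ‖w_{φ(i+1)} - w_{φ(i)}‖ ≤ 2^{-i}` (from `L²` via
`|x| ≤ (t x² + t⁻¹)/2` with `t = 2^i` on the probability space). [folklore] -/
theorem integral_norm_sub_le (i : ℕ) :
    ∫ x, ‖D.state (D.sub (i + 1)) x - D.state (D.sub i) x‖ ≤ (1 / 2) ^ i := by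
  set G : UnitAddTorus d → State d := fun x => D.state (D.sub (i + 1)) x - D.state (D.sub i) x with hG
  have hGc : Continuous G := (D.state_continuous _).sub (D.state_continuous _)
  have ht : (0 : ℝ) < 2 ^ i := by positivity
  have hpt : ∀ x, ‖G x‖ ≤ (2 ^ i * ‖G x‖ ^ 2 + (2 ^ i)⁻¹) / 2 := fun x => by
    have h := sq_nonneg (2 ^ i * ‖G x‖ - 1)
    have h2 : (2 : ℝ) ^ i * (2 ^ i)⁻¹ = 1 := mul_inv_cancel₀ ht.ne'
    nlinarith [norm_nonneg (G x), h2, inv_pos.2 ht]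
  have hI2 : Integrable fun x => ‖G x‖ ^ 2 := (hGc.norm.pow 2).integrable_unitAddTorus
  calc ∫ x, ‖G x‖ ≤ ∫ x, (2 ^ i * ‖G x‖ ^ 2 + (2 ^ i)⁻¹) / 2 :=
        integral_mono hGc.norm.integrable_unitAddTorus (((hI2.const_mul _).add (integrable_const _)).div_const _) hpt
    _ = (2 ^ i * (∫ x, ‖G x‖ ^ 2) + (2 ^ i)⁻¹) / 2 := by
        rw [integral_div, integral_add (hI2.const_mul _) (integrable_const _), integral_const_mul]
        simp
    _ ≤ (2 ^ i * (1 / 4) ^ i + (2 ^ i)⁻¹) / 2 := by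
        have h := (D.integral_sq_sub_lt (Nat.le_succ i)).le
        have h' : (∫ x, ‖G x‖ ^ 2) ≤ (1 / 4) ^ i := h
        gcongr
    _ = (1 / 2) ^ i := by
        have h1 : (2 : ℝ) ^ i * (1 / 4) ^ i = (1 / 2) ^ i := by rw [← mul_pow]; norm_num
        have h2 : ((2 : ℝ) ^ i)⁻¹ = (1 / 2) ^ i := by rw [← inv_pow]; norm_num
        rw [h1, h2]; ring

/-- **Almost everywhere convergence along the subsequence** (summable `L¹` increments).
[folklore] -/
theorem ae_exists_tendsto : ∀ᵐ x, ∃ l : State d, Tendsto (fun i => D.state (D.sub i) x) atTop (𝓝 l) := by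
  set G : ℕ → UnitAddTorus d → State d := fun i x => D.state (D.sub i) x with hG
  have hGc : ∀ i, Continuous (G i) := fun i => D.state_continuous _
  have hmeas : ∀ i, AEMeasurable (fun x => ‖G (i + 1) x - G i x‖ₑ) volume := fun i =>
    (((hGc (i + 1)).sub (hGc i)).measurable.enorm).aemeasurable
  have h1 : ∫⁻ x, ∑' i, ‖G (i + 1) x - G i x‖ₑ = ∑' i, ∫⁻ x, ‖G (i + 1) x - G i x‖ₑ := lintegral_tsum hmeas
  have h2 : ∀ i, ∫⁻ x, ‖G (i + 1) x - G i x‖ₑ ≤ ENNReal.ofReal ((1 / 2) ^ i) := by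
    intro i
    have hint : Integrable (fun x => G (i + 1) x - G i x) := ((hGc (i + 1)).sub (hGc i)).integrable_unitAddTorus
    rw [← ofReal_integral_norm_eq_lintegral_enorm hint]
    exact ENNReal.ofReal_le_ofReal (D.integral_norm_sub_le i)
  have hgeo : Summable fun i : ℕ => ((1 : ℝ) / 2) ^ i := summable_geometric_of_lt_one (by norm_num) (by norm_num)
  have h3 : ∫⁻ x, ∑' i, ‖G (i + 1) x - G i x‖ₑ < ⊤ := by
    rw [h1]
    calc ∑' i, ∫⁻ x, ‖G (i + 1) x - G i x‖ₑ ≤ ∑' i, ENNReal.ofReal ((1 / 2) ^ i) := ENNReal.tsum_le_tsum h2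
      _ = ENNReal.ofReal (∑' i, ((1 : ℝ) / 2) ^ i) := (ENNReal.ofReal_tsum_of_nonneg (fun i => by positivity) hgeo).symm
      _ < ⊤ := ENNReal.ofReal_lt_top
  have hmeas' : Measurable fun x => ∑' i, ‖G (i + 1) x - G i x‖ₑ := by
    simp_rw [ENNReal.tsum_eq_iSup_sum]
    exact .iSup fun s => s.measurable_fun_sum fun i _ => ((hGc (i + 1)).sub (hGc i)).measurable.enorm
  have h4 : ∀ᵐ x, ∑' i, ‖G (i + 1) x - G i x‖ₑ < ⊤ := ae_lt_top hmeas' h3.ne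
  filter_upwards [h4] with x hx
  have hsum : Summable fun i => G (i + 1) x - G i x := .of_nnnorm <| ENNReal.tsum_coe_ne_top_iff_summable.mp hx.ne
  have hx_sum := hsum.hasSum.tendsto_sum_nat
  rw [funext fun n => Finset.sum_range_sub (fun m => G m x) n] at hx_sum
  exact ⟨∑' i, (G (i + 1) x - G i x) + G 0 x, by simpa using hx_sum.add_const (G 0 x)⟩

/-- The states converge to the limit state a.e. [folklore] -/
theorem ae_tendsto_wlim : ∀ᵐ x, Tendsto (fun i => D.state (D.sub i) x) atTop (𝓝 (D.wlim x)) := by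
  filter_upwards [D.ae_exists_tendsto] with x hx
  exact tendsto_nhds_limUnder hx

/-- The limit state is a.e.-strongly measurable. [folklore] -/
theorem aestronglyMeasurable_wlim : AEStronglyMeasurable D.wlim volume :=
  aestronglyMeasurable_of_tendsto_ae atTop (fun i => (D.state_continuous (D.sub i)).aestronglyMeasurable) D.ae_tendsto_wlim

/-- **The limit is bounded by `R`** a.e. [folklore] -/
theorem ae_norm_wlim_le : ∀ᵐ x, ‖D.wlim x‖ ≤ D.R := by
  filter_upwards [D.ae_tendsto_wlim] with x hx
  exact isClosed_Iic.mem_of_tendsto ((continuous_norm.tendsto _).comp hx) (Eventually.of_forall fun i => D.norm_state_le _ x)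

/-- **The limit takes values in `𝒦^{co}_{e(x)}`** a.e. (closedness). [cite: ChoffrutSzekelyhidi2014, §2, Step 3] -/
theorem ae_wlim_mem_C : ∀ᵐ x, D.wlim x ∈ C (D.e x) := by
  filter_upwards [D.ae_tendsto_wlim] with x hx
  have h := isClosed_setOf_mem_C (d := d) |>.mem_of_tendsto ((tendsto_const_nhds (x := D.e x)).prodMk_nhds hx)
    (Eventually.of_forall fun i => D.state_mem_C (D.sub i) x)
  exact h

/-- **`|v|² = e` a.e. for the limit**: the defects `J(w_{φ(i)}) → 0` and dominated convergence.
[cite: ChoffrutSzekelyhidi2014, §2, Step 3] -/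
theorem ae_norm_vel_wlim_sq : ∀ᵐ x, ‖vel (D.wlim x)‖ ^ 2 = D.e x := by
  set g : ℕ → UnitAddTorus d → ℝ := fun i x => D.e x - ‖vel (D.state (D.sub i) x)‖ ^ 2 with hg
  set gl : UnitAddTorus d → ℝ := fun x => D.e x - ‖vel (D.wlim x)‖ ^ 2 with hgl
  have hgc : ∀ i, Continuous (g i) := fun i =>
    D.he.sub ((continuous_norm.comp (continuous_vel.comp (D.state_continuous _))).pow 2)
  -- dominated convergence: `∫ g i → ∫ gl`
  have hbound : ∀ i, ∀ᵐ x, ‖g i x‖ ≤ D.ebar + D.R ^ 2 := fun i => Eventually.of_forall fun x => by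
    rw [Real.norm_eq_abs, abs_le]
    have h1 := D.norm_vel_state_sq_le (D.sub i) x
    have h2 := D.e_nonneg x
    have h3 := D.e_le_ebar x
    have h4 : ‖vel (D.state (D.sub i) x)‖ ^ 2 ≤ D.R ^ 2 :=
      pow_le_pow_left₀ (norm_nonneg _) ((norm_vel_le _).trans (D.norm_state_le _ x)) 2
    constructor <;> simp only [hg] <;> nlinarith [sq_nonneg D.R]
  have hlim : ∀ᵐ x, Tendsto (fun i => g i x) atTop (𝓝 (gl x)) := by
    filter_upwards [D.ae_tendsto_wlim] with x hx
    exact tendsto_const_nhds.sub (((continuous_norm.comp continuous_vel).tendsto _).comp hx |>.pow 2)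
  have hT := tendsto_integral_of_dominated_convergence (fun _ => D.ebar + D.R ^ 2)
    (fun i => (hgc i).aestronglyMeasurable) (integrable_const _) hbound hlim
  -- but `∫ g i = J (φ i) → 0`
  have hJ : Tendsto (fun i => ∫ x, g i x) atTop (𝓝 0) := by
    have := D.tendsto_defect.comp D.sub_strictMono.tendsto_atTop
    exact this
  have h0 : ∫ x, gl x = 0 := tendsto_nhds_unique hT hJ
  -- `gl ≥ 0` a.e. and integrable
  have hgl0 : 0 ≤ᵐ[volume] gl := by
    filter_upwards [D.ae_wlim_mem_C] with x hx
    exact sub_nonneg.2 (norm_vel_sq_le_of_mem_C hx)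
  have hgli : Integrable gl := by
    refine Integrable.mono' (integrable_const (D.ebar + D.R ^ 2)) ?_ ?_
    · exact aestronglyMeasurable_of_tendsto_ae atTop (fun i => (hgc i).aestronglyMeasurable) hlim
    · filter_upwards [D.ae_norm_wlim_le, D.ae_wlim_mem_C] with x hx hC
      rw [Real.norm_eq_abs, abs_le]
      have h1 := norm_vel_sq_le_of_mem_C hC
      have h2 := nonneg_of_mem_C hC
      have h3 := D.e_le_ebar x
      have h4 : ‖vel (D.wlim x)‖ ^ 2 ≤ D.R ^ 2 := pow_le_pow_left₀ (norm_nonneg _) ((norm_vel_le _).trans hx) 2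
      constructor <;> simp only [hgl] <;> nlinarith [sq_nonneg D.R]
  have hae := (integral_eq_zero_iff_of_nonneg_ae hgl0 hgli).1 h0
  filter_upwards [hae] with x hx
  simp only [hgl, Pi.zero_apply] at hx
  linarith

/-- **The limit lies in `𝒦_{e(x)}` a.e.**: `u = v ⊗ v - e/d Id`, `|v|² = e`.
[cite: ChoffrutSzekelyhidi2014, §2, Step 3 and (2.6)] -/
theorem ae_wlim_mem_K : ∀ᵐ x, D.wlim x ∈ K (D.e x) := by
  filter_upwards [D.ae_wlim_mem_C, D.ae_norm_vel_wlim_sq] with x hC hv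
  exact mem_K_of_mem_C_of_norm_sq_eq hC hv

/-- The limit velocity is integrable (bounded and measurable). [folklore] -/
theorem integrable_vel_wlim : Integrable (fun x => vel (D.wlim x)) volume := by
  refine Integrable.mono' (integrable_const D.R) (continuous_vel.comp_aestronglyMeasurable D.aestronglyMeasurable_wlim) ?_
  filter_upwards [D.ae_norm_wlim_le] with x hx
  exact (norm_vel_le _).trans hx

omit [Fintype d] [DecidableEq d] [Nonempty d] in
/-- A continuous real function on the torus is bounded. [folklore] -/
theorem exists_abs_bound_of_continuous {f : UnitAddTorus d → ℝ} (hf : Continuous f) : ∃ B, 0 ≤ B ∧ ∀ x, |f x| ≤ B := by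
  obtain ⟨B, hB⟩ := (isCompact_range hf).isBounded.exists_norm_le
  exact ⟨max B 0, le_max_right _ _, fun x => (hB _ ⟨x, rfl⟩).trans (le_max_left _ _)⟩

/-- **Dominated convergence for linear observables of the states**:
`∫ Σᵢ (w_{φ(j)})_{cᵢ} aᵢ → ∫ Σᵢ w_{cᵢ} aᵢ` for continuous coefficients `aᵢ`. [folklore] -/
theorem tendsto_integral_sum_coord_mul {ι : Type*} [Fintype ι] (c : ι → Idx d) (a : ι → UnitAddTorus d → ℝ)
    (ha : ∀ i, Continuous (a i)) :
    Tendsto (fun j => ∫ x, ∑ i, D.state (D.sub j) x (c i) * a i x) atTop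
      (𝓝 (∫ x, ∑ i, D.wlim x (c i) * a i x)) := by
  choose B hB0 hB using fun i => exists_abs_bound_of_continuous (ha i)
  have hcoord : ∀ (s : State d) (k : Idx d), |s k| ≤ ‖s‖ := fun s k => by
    simpa using PiLp.norm_apply_le s k
  refine tendsto_integral_of_dominated_convergence (fun _ => ∑ i, D.R * B i) (fun j => ?_) (integrable_const _)
    (fun j => Eventually.of_forall fun x => ?_) ?_
  · exact (continuous_finsetSum _ fun i _ => (((PiLp.continuous_apply 2 (fun _ : Idx d => ℝ) (c i)).comp
      (D.state_continuous _)).mul (ha i))).aestronglyMeasurable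
  · rw [Real.norm_eq_abs]
    refine (Finset.abs_sum_le_sum_abs _ _).trans (Finset.sum_le_sum fun i _ => ?_)
    rw [abs_mul]
    exact mul_le_mul ((hcoord _ _).trans (D.norm_state_le _ x)) (hB i x) (abs_nonneg _) D.R_nonneg
  · filter_upwards [D.ae_tendsto_wlim] with x hx
    exact tendsto_finsetSum _ fun i _ =>
      ((((PiLp.continuous_apply 2 (fun _ : Idx d => ℝ) (c i)).tendsto _).comp hx).mul tendsto_const_nhds)

/-- **Linear observables of the limit with continuous coefficients are integrable.** [folklore] -/
theorem integrable_sum_coord_mul {ι : Type*} [Fintype ι] (c : ι → Idx d) (a : ι → UnitAddTorus d → ℝ)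
    (ha : ∀ i, Continuous (a i)) : Integrable (fun x => ∑ i, D.wlim x (c i) * a i x) volume := by
  choose B hB0 hB using fun i => exists_abs_bound_of_continuous (ha i)
  have hcoord : ∀ (s : State d) (k : Idx d), |s k| ≤ ‖s‖ := fun s k => by
    simpa using PiLp.norm_apply_le s k
  refine Integrable.mono' (integrable_const (∑ i, D.R * B i)) ?_ ?_
  · exact Finset.aestronglyMeasurable_fun_sum _ fun i _ =>
      (((PiLp.continuous_apply 2 (fun _ : Idx d => ℝ) (c i)).comp_aestronglyMeasurable D.aestronglyMeasurable_wlim).mul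
        (ha i).aestronglyMeasurable)
  · filter_upwards [D.ae_norm_wlim_le] with x hx
    rw [Real.norm_eq_abs]
    refine (Finset.abs_sum_le_sum_abs _ _).trans (Finset.sum_le_sum fun i _ => ?_)
    rw [abs_mul]
    exact mul_le_mul ((hcoord _ _).trans hx) (hB i x) (abs_nonneg _) D.R_nonneg

/-- **Weak `div v` of the limit is that of `w₀`.** [cite: ChoffrutSzekelyhidi2014, Lemma 2] -/
theorem wlim_weak_vel {θ : UnitAddTorus d → ℝ} (hθ : Torus.IsSmooth θ) :
    ∫ x, ∑ i, vel (D.wlim x) i * Torus.partialDeriv i θ x = ∫ x, ∑ i, vel (D.w₀ x) i * Torus.partialDeriv i θ x := by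
  have h := D.tendsto_integral_sum_coord_mul (fun i : d => Sum.inl i) (fun i => Torus.partialDeriv i θ)
    fun i => (hθ.partialDeriv i).continuous
  have h0 : ∀ j, ∫ x, ∑ i, D.state (D.sub j) x (Sum.inl i) * Torus.partialDeriv i θ x =
      ∫ x, ∑ i, vel (D.w₀ x) i * Torus.partialDeriv i θ x := fun j => by
    simpa only [vel_apply] using D.state_weak_vel (D.sub j) hθ
  simp only [h0] at h
  simpa only [vel_apply] using (tendsto_nhds_unique h tendsto_const_nhds)

/-- **Weak `div u` (tested with divergence-free fields) of the limit is that of `w₀`.** [cite: ChoffrutSzekelyhidi2014, Lemma 2] -/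
theorem wlim_weak_str {Φ : UnitAddTorus d → Ed d} (hΦ : Torus.IsSmooth Φ) (hdiv : Torus.IsDivFree Φ) :
    ∫ x, ∑ i, ∑ j, str (D.wlim x) i j * Torus.partialDeriv j (fun y => Φ y i) x =
      ∫ x, ∑ i, ∑ j, str (D.w₀ x) i j * Torus.partialDeriv j (fun y => Φ y i) x := by
  have h := D.tendsto_integral_sum_coord_mul (fun ij : d × d => Sum.inr ij)
    (fun ij => Torus.partialDeriv ij.2 (fun y => Φ y ij.1)) fun ij => ((hΦ.apply ij.1).partialDeriv ij.2).continuous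
  have h0 : ∀ k, ∫ x, ∑ ij : d × d, D.state (D.sub k) x (Sum.inr ij) * Torus.partialDeriv ij.2 (fun y => Φ y ij.1) x =
      ∫ x, ∑ i, ∑ j, str (D.w₀ x) i j * Torus.partialDeriv j (fun y => Φ y i) x := by
    intro k
    have := D.state_weak_str (D.sub k) hΦ hdiv
    simpa only [str_apply, Fintype.sum_prod_type] using this
  simp only [h0] at h
  have hl := tendsto_nhds_unique h tendsto_const_nhds
  simpa only [str_apply, Fintype.sum_prod_type] using hl

/-- **The coordinate means of the limit are those of `w₀`.** [folklore] -/
theorem integral_wlim_apply (c : Idx d) : ∫ x, D.wlim x c = ∫ x, D.w₀ x c := by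
  have h := D.tendsto_integral_sum_coord_mul (fun _ : Unit => c) (fun _ _ => (1 : ℝ)) fun _ => continuous_const
  simp only [Finset.univ_unique, Finset.sum_singleton, mul_one, D.integral_state_apply] at h
  exact tendsto_nhds_unique h tendsto_const_nhds

/-- **The pairing of the limit with `q` is within `θ` of that of `w₀`.** [folklore] -/
theorem abs_integral_inner_wlim_q_sub_le : |(∫ x, ⟪D.wlim x, D.q x⟫_ℝ) - ∫ x, ⟪D.w₀ x, D.q x⟫_ℝ| ≤ D.θ := by
  have hq : ∀ c, Continuous fun x => D.q x c := fun c => (PiLp.continuous_apply 2 (fun _ : Idx d => ℝ) c).comp D.hq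
  have h := D.tendsto_integral_sum_coord_mul (fun c : Idx d => c) (fun c x => D.q x c) hq
  have hinner : ∀ (s : UnitAddTorus d → State d) (x : UnitAddTorus d), ⟪s x, D.q x⟫_ℝ = ∑ c, s x c * D.q x c := by
    intro s x
    rw [PiLp.inner_apply]
    exact Finset.sum_congr rfl fun c _ => by simp [mul_comm]
  have hk : ∀ k, |(∫ x, ∑ c, D.state (D.sub k) x c * D.q x c) - ∫ x, ⟪D.w₀ x, D.q x⟫_ℝ| ≤ D.θ := fun k => by
    have := D.abs_ip_state_q_sub_le_θ (D.sub k)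
    simp only [ip, hinner (D.state (D.sub k))] at this
    exact this
  have hlim : Tendsto (fun k => (∫ x, ∑ c, D.state (D.sub k) x c * D.q x c) - ∫ x, ⟪D.w₀ x, D.q x⟫_ℝ) atTop
      (𝓝 ((∫ x, ∑ c, D.wlim x c * D.q x c) - ∫ x, ⟪D.w₀ x, D.q x⟫_ℝ)) := h.sub tendsto_const_nhds
  have hmem := isClosed_Icc.mem_of_tendsto hlim (Eventually.of_forall fun k => abs_le.1 (hk k))
  simp_rw [hinner D.wlim]
  exact abs_le.2 hmem

end FIterData

end ForcedFlows

end Summit.AnomalousDissipation.AnomalousDissipation.Theorems
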